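import Literature.Algebra.Homology.HyperExt
import Mathlib.Algebra.Homology.DerivedCategory.Ext.Map
import HarnessLib

/-!
# Hyper-Ext groups and exact functors

For an exact functor `F : C ⥤ D` between abelian categories (additive, preserving finite limits and
colimits), an object `X : C` and a cochain complex `K`, this file constructs the induced maps on
hyper-Ext groups (`Literature/Algebra/Homology/HyperExt.lean`:
`HyperExt X K n = Hom_{D(C)}(X[0], K⟦n⟧)`)

  `HyperExt.mapExactFunctor F n : HyperExt X K n →+ HyperExt (F X) (F K) n`

— Mathlib's `Abelian.Ext.mapExactFunctor` (file `DerivedCategory/Ext/Map`) with the single complex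
`Y[0]` replaced by an arbitrary complex — and proves that they are compatible with

* the functoriality in the complex (`mapExactFunctor_map`), and
* the **connecting homomorphisms** of short exact sequences of complexes
  (`mapExactFunctor_delta`: `F(δ_S x) = δ_{F S}(F x)`), via Mathlib's
  `DerivedCategory.map_triangleOfSESδ` (an exact functor maps the triangle of `S` to that of `F S`).

Construction: as for `HyperExt.map`/`HyperExt.delta`, everything is transported through
`HyperExt.homAddEquiv` to the constructed derived categories (`HasDerivedCategory.standard`), where
the map is `x ↦ e_X⁻¹ ≫ D(F)(x) ≫ e_K⟦n⟧` for the triangulated functor `D(F) = F.mapDerivedCategory`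
and the isomorphisms `e_X : D(F)(X[0]) ≅ (F X)[0]`, `e_K : D(F)(Q K) ≅ Q (F K)`
(`homAddEquiv_mapExactFunctor`); users only see intrinsic statements.

## Why

With `C = Sh(X)`, `D = Sh(U)` for an open `U ⊆ X` and `F = j⁻¹` (exact), these are the restriction
maps `ℍⁿ(X, K) → ℍⁿ(U, K|_U)` on hypercohomology and their compatibility with the connecting maps
of the stupid filtration — the formal half of "Hodge-to-de Rham differentials commute with
restriction to the generic fibre" used around `Crystalline.HodgeDeRhamDegeneratesModTorsion`.

## Not here

Compatibility with `HyperExt.extEquiv` / `Abelian.Ext.mapExactFunctor` in degree-`0` complexes, and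
the identification `F(σ≤n K) = σ≤n F(K)` of stupid truncations (a statement about
`stupidFiltrationShortComplex`, not about `HyperExt`).

## References

* C. A. Weibel, *An introduction to homological algebra*, CUP 1994, Def. 10.7.1, §10.5,
  Example 10.4.9. [Weibel1994]
-/

universe w w' v v' u u'

open CategoryTheory Limits DerivedCategory

namespace Literature.Algebra.Homology

namespace HyperExt

variable {C : Type u} [Category.{v} C] [Abelian C] {D : Type u'} [Category.{v'} D] [Abelian D]
  (F : C ⥤ D) [F.Additive] [PreservesFiniteLimits F] [PreservesFiniteColimits F]
  {X : C} {K L : CochainComplex C ℤ} [HasHyperExt.{w} X K] [HasHyperExt.{w} X L]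
  [HasHyperExt.{w'} (F.obj X) ((F.mapHomologicalComplex (ComplexShape.up ℤ)).obj K)]
  [HasHyperExt.{w'} (F.obj X) ((F.mapHomologicalComplex (ComplexShape.up ℤ)).obj L)]
  {n : ℤ}

-- `DerivedCategory.singleFunctor C 0 ⋙ F.mapDerivedCategory` vs `F ⋙ singleFunctor D 0`, and
-- `(S.map F).Xᵢ` vs `F.obj S.Xᵢ`, are equal only up to unfolding.
set_option backward.isDefEq.respectTransparency false

variable (n) in
/-- **Functoriality of hyper-Ext along an exact functor.** For an exact functor `F : C ⥤ D` between
abelian categories, the additive map `HyperExt X K n →+ HyperExt (F X) (F K) n`,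
`Hom_{D(C)}(X[0], K⟦n⟧) → Hom_{D(D)}(F X[0], F K⟦n⟧)`: apply the induced triangulated functor
`D(F) : D(C) ⥤ D(D)` (Mathlib `Functor.mapDerivedCategory`, in the constructed derived categories)
and conjugate by the canonical isomorphisms `D(F)(X[0]) ≅ (F X)[0]`
(`Functor.mapDerivedCategorySingleFunctor`) and `D(F)(K) ≅ F(K)`
(`Functor.mapDerivedCategoryFactors`).
This is Mathlib's `Abelian.Ext.mapExactFunctor` with the single complex `Y[0]` replaced by an
arbitrary complex `K` (Weibel 10.7.1 with 10.5: an exact functor passes to derived categories).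
[cite: Weibel1994, Def. 10.7.1] -/
noncomputable def mapExactFunctor :
    HyperExt.{w} X K n →+
      HyperExt.{w'} (F.obj X) ((F.mapHomologicalComplex (ComplexShape.up ℤ)).obj K) n :=
  letI := HasDerivedCategory.standard C
  letI := HasDerivedCategory.standard D
  AddMonoidHom.mk' (fun x => homAddEquiv.symm
    ((ShiftedHom.mk₀ (0 : ℤ) rfl ((F.mapDerivedCategorySingleFunctor 0).inv.app X)).comp
      (((homAddEquiv x).map F.mapDerivedCategory).comp
        (ShiftedHom.mk₀ (0 : ℤ) rfl (F.mapDerivedCategoryFactors.hom.app K)) (zero_add n))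
      (add_zero n)))
    (fun x y => by
      rw [← map_add]
      congr 1
      rw [map_add, ShiftedHom.map_add, ShiftedHom.add_comp, ShiftedHom.comp_add])

/-- `mapExactFunctor` in the constructed derived categories, unfolded: `e_X⁻¹ ≫ D(F)(x) ≫ e_K⟦n⟧`.
[folklore] -/
theorem homAddEquiv_mapExactFunctor (x : HyperExt.{w} X K n) :
    letI := HasDerivedCategory.standard C
    letI := HasDerivedCategory.standard D
    homAddEquiv (mapExactFunctor F n x) =
      (F.mapDerivedCategorySingleFunctor 0).inv.app X ≫
        (homAddEquiv x).map F.mapDerivedCategory ≫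
          (F.mapDerivedCategoryFactors.hom.app K)⟦n⟧' := by
  letI := HasDerivedCategory.standard C
  letI := HasDerivedCategory.standard D
  change homAddEquiv (homAddEquiv.symm _) = _
  rw [AddEquiv.apply_symm_apply, ShiftedHom.comp_mk₀, ShiftedHom.mk₀_comp]

/-- **Naturality in the complex**: `mapExactFunctor` commutes with the maps induced by a morphism of
complexes `f : K ⟶ L` (naturality of `Functor.mapDerivedCategoryFactors`). [folklore] -/
theorem mapExactFunctor_map (f : K ⟶ L) (x : HyperExt.{w} X K n) :
    mapExactFunctor F n (map f n x) =
      map ((F.mapHomologicalComplex _).map f) n (mapExactFunctor F n x) := by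
  letI := HasDerivedCategory.standard C
  letI := HasDerivedCategory.standard D
  apply homAddEquiv.injective
  rw [homAddEquiv_mapExactFunctor, homAddEquiv_map, homAddEquiv_map, homAddEquiv_mapExactFunctor]
  simp only [ShiftedHom.map, Functor.map_comp, Category.assoc,
    Functor.commShiftIso_hom_naturality_assoc]
  rw [← Functor.map_comp, ← Functor.map_comp, F.mapDerivedCategoryFactors_hom_naturality]

section Delta

variable {S : ShortComplex (CochainComplex C ℤ)} (hS : S.ShortExact)
  [HasHyperExt.{w} X S.X₁] [HasHyperExt.{w} X S.X₃]
  [h₁ : HasHyperExt.{w'} (F.obj X) ((F.mapHomologicalComplex (ComplexShape.up ℤ)).obj S.X₁)]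
  [h₃ : HasHyperExt.{w'} (F.obj X) ((F.mapHomologicalComplex (ComplexShape.up ℤ)).obj S.X₃)]

omit [HasHyperExt.{w} X K]
  [HasHyperExt.{w'} (F.obj X) ((F.mapHomologicalComplex (ComplexShape.up ℤ)).obj K)] in
/-- **`mapExactFunctor` commutes with the connecting homomorphisms** of the long exact sequences of
a short exact sequence of complexes `S` and of its (short exact) image `F(S)`: an exact functor
maps the distinguished triangle of `S` to that of `F(S)` (Mathlib
`DerivedCategory.map_triangleOfSESδ`;
Weibel Example 10.4.9). The `HasHyperExt` hypotheses on the `D` side are taken in the form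
`HasHyperExt (F X) (F Sᵢ)` that `mapExactFunctor` uses and transported (they are propositions) to
the form `HasHyperExt (F X) (F(S)).Xᵢ` that `delta` uses. [cite: Weibel1994, Example 10.4.9] -/
theorem mapExactFunctor_delta (n₀ n₁ : ℤ) (h : n₀ + 1 = n₁) (x : HyperExt.{w} X S.X₃ n₀) :
    haveI : HasHyperExt.{w'} (F.obj X)
      (S.map (F.mapHomologicalComplex (ComplexShape.up ℤ))).X₁ := h₁
    haveI : HasHyperExt.{w'} (F.obj X)
      (S.map (F.mapHomologicalComplex (ComplexShape.up ℤ))).X₃ := h₃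
    mapExactFunctor F n₁ (delta hS n₀ n₁ h x) =
      delta (hS.map_of_exact (F.mapHomologicalComplex (ComplexShape.up ℤ))) n₀ n₁ h
        (mapExactFunctor F n₀ x) := by
  letI := HasDerivedCategory.standard C
  letI := HasDerivedCategory.standard D
  apply homAddEquiv.injective
  have eR : homAddEquiv (K := (F.mapHomologicalComplex (ComplexShape.up ℤ)).obj S.X₁)
      (haveI : HasHyperExt.{w'} (F.obj X)
          (S.map (F.mapHomologicalComplex (ComplexShape.up ℤ))).X₁ := h₁
       haveI : HasHyperExt.{w'} (F.obj X)
          (S.map (F.mapHomologicalComplex (ComplexShape.up ℤ))).X₃ := h₃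
       delta (hS.map_of_exact (F.mapHomologicalComplex (ComplexShape.up ℤ))) n₀ n₁ h
        (mapExactFunctor F n₀ x)) =
      homAddEquiv (mapExactFunctor F n₀ x) ≫
        (triangleOfSESδ (hS.map_of_exact (F.mapHomologicalComplex (ComplexShape.up ℤ))))⟦n₀⟧' ≫
          (shiftFunctorAdd' (DerivedCategory D) 1 n₀ n₁ (by omega)).inv.app
            (Q.obj ((F.mapHomologicalComplex (ComplexShape.up ℤ)).obj S.X₁)) :=
    @homAddEquiv_delta' D _ _ (F.obj X) (S.map (F.mapHomologicalComplex (ComplexShape.up ℤ)))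
      (hS.map_of_exact (F.mapHomologicalComplex (ComplexShape.up ℤ))) h₁ h₃ n₀ n₁ h
      (mapExactFunctor F n₀ x)
  have eL : homAddEquiv (delta hS n₀ n₁ h x) =
      (homAddEquiv x).comp (M := ℤ) (triangleOfSESδ hS) (show (1 : ℤ) + n₀ = n₁ by omega) :=
    homAddEquiv_delta' hS n₀ n₁ h x
  rw [homAddEquiv_mapExactFunctor, eR, homAddEquiv_mapExactFunctor, eL, ShiftedHom.map_comp]
  -- the image of the connecting morphism of `hS` under `F.mapDerivedCategory`
  have hδ : F.mapDerivedCategory.map (triangleOfSESδ hS) ≫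
      (F.mapDerivedCategory.commShiftIso (1 : ℤ)).hom.app (Q.obj S.X₁) =
      F.mapDerivedCategoryFactors.hom.app S.X₃ ≫
        triangleOfSESδ (hS.map_of_exact (F.mapHomologicalComplex (ComplexShape.up ℤ))) ≫
          (F.mapDerivedCategoryFactors.inv.app S.X₁)⟦(1 : ℤ)⟧' := by
    rw [DerivedCategory.map_triangleOfSESδ]
    simp only [Category.assoc, Iso.inv_hom_id_app]
    erw [Category.comp_id]
  have hδ' := (shiftFunctor (DerivedCategory D) n₀).congr_map hδ
  simp only [Functor.map_comp] at hδ'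
  have hn : ((F.mapDerivedCategoryFactors.inv.app S.X₁)⟦(1 : ℤ)⟧')⟦n₀⟧' ≫
      (shiftFunctorAdd' (DerivedCategory D) 1 n₀ n₁ (by omega)).inv.app
        (F.mapDerivedCategory.obj (Q.obj S.X₁)) ≫
        (F.mapDerivedCategoryFactors.hom.app S.X₁)⟦n₁⟧' =
      (shiftFunctorAdd' (DerivedCategory D) 1 n₀ n₁ (by omega)).inv.app
        (Q.obj ((F.mapHomologicalComplex (ComplexShape.up ℤ)).obj S.X₁)) := by
    erw [(shiftFunctorAdd' (DerivedCategory D) 1 n₀ n₁ (by omega)).inv.naturality_assoc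
      (F.mapDerivedCategoryFactors.inv.app S.X₁)]
    erw [← Functor.map_comp, Iso.inv_hom_id_app, CategoryTheory.Functor.map_id, Category.comp_id]
    rfl
  simp only [ShiftedHom.comp, ShiftedHom.map, Functor.map_comp, Category.assoc]
  rw [reassoc_of% hδ', hn]

end Delta

end HyperExt

end Literature.Algebra.Homology
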